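import Summits.QuantumFields.YangMills.Theorems.UnitScaleTiltProp7SectET3N06LeavesRecordNormGReduced
import Summits.QuantumFields.YangMills.Theorems.UnitScaleTiltProp7SectET3N06LeavesRecordNormH1Reduced
import Summits.QuantumFields.YangMills.Theorems.UnitScaleTiltProp7SectET3ClassTransferRows
import HarnessLib

/-!
# Route `UnitScaleTilt` (α), node N06(d = 3) — **THE REDUCED `norm_G` ∕ `norm_H₁` ROWS WITH THE CLASS-TRANSFER INPUT IN THE PRINT-FAITHFUL ∃-SHAPE (BG-336)′**: ✓
# `Prop7SectET3N06LeavesRecordNormGReduced.normG_row_of_evaluationRows` and ✓ `Prop7SectET3N06LeavesRecordNormH1Reduced.normH₁_row_of_evaluationRows` (ym-inputs-p05, structural rows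
# discharged) with ★w1-20520's binder `hCT : ClassTransferT3 ℓ hL c35` (the ∀-α₀ row, typing flag (F1) of INPUT-LIST I-07, unsupplied by print) REPLACED by ym-inputs-p06's ∃-shape
# `hCTS` of ✓ `Prop7SectET3ClassTransferRows` — which ✓ `Prop7SectET3ClassTransfer.reg335_reg336_T3_of_regPr` ([Balaban1985RegularSpaces] Prop. 6 at the T³ class) DISCHARGES for every
# leaf constant `c35 ≥ c35₀(L)`; every other binder and both conclusions VERBATIM

Cell `ym-inputs` (D-0154 (2); desk `ym-inputs-plan-1` INPUT-LIST v6 §4 rows p05 (I-06 (d)) and p06 (I-07); ym-inputs-p06's OFFER 2026-08-28T09:10:09Z «record-level twins with `hCT`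
dropped = 1-line compositions — yours to word»), seat ym-inputs-p05.  Count-neutral helper (`--supports stmt-QuantumFields-20520 --as helper`; RULING g26-№2); registry untouched;
THEOREMS ONLY (0 `def`, 0 `sorry`); NOTHING of [Balaban1985BackgroundPropagators] ∕ [Balaban1985RegularSpaces] is asserted.

THE COMPOSITION.  As in the two parent files (canonical kernel families by ✓ `exists_kernelFamily_structural`, symmetry rows by ✓ `hsymGG_row_of_letterSymm` ∕ ✓ `hsym_row_of_letterSymm`,
(3.47) pin from the dominations + the readout row), but the last step composes the LEAVES OF RECORD (`t313_of_pins_T3_completePairMBZ`, `t312_of_pins_T3_completePairMBZ`, pins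
`HasRWExpOfOps`∕`HasRWExpHOfOps`∕`PosDefKOfOps`) with p06's ∃-shape rows `normG_row_of_t313_classTransferS` ∕ `normH₁_row_of_t312_classTransferS` instead of ★w1's `…_classTransfer`.
NET: on the record `norm_G` ∕ `norm_H₁` edges the DISPLAYED obligations are now — evaluation rows, letter symmetries, readout∕pin, the ANALYTIC rows (Thm 3.3 for G₀ (XL), steps, letters,
(3.43)–(3.46) members; on the H side also the H-kernel interface) and `hCTS` (dischargeable BY NAME); no kernel family, no structural row, no ∀-α₀ class-transfer row.
HONEST SCOPE: bookkeeping (two `exact`s over landed theorems); N06(d = 3) NOT discharged; nothing here claims EX, the crux, V3∕R3, d = 4 or the mass gap; rung R3, not Clay.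

References: T. Bałaban, CMP **99** (1985) 389–434 [Balaban1985BackgroundPropagators] (Thm 3.12 p.423, Thm 3.13 p.426, (3.39)–(3.47) pp.397–398); CMP **102** (1985) 277–309
[Balaban1985Variational] ((103) p.293, (115) p.294, (117) p.295); CMP **99** (1985) 75–102 [Balaban1985RegularSpaces] ((1.33) p.82, Prop. 6 p.99).
-/

set_option autoImplicit false

noncomputable section

open scoped Matrix.Norms.L2Operator

namespace Summit.QuantumFields.YangMills.Theorems.Prop7SectET3N06LeavesRecordReducedS

open Literature.MathematicalPhysics.QuantumFieldTheory.Balaban1983to89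
open Finset B6RandomWalk B6RandomWalkHom B9Thm34Ext B9Thm37Glue B9Thm37GlueCor36 B11SectG B9SectDSup B9SectDL2Decay B9Thm37AllNorms
open B9Thm37AllNormsInstances B9FromB6 B9FromB6ModelSignsOn B9SectBStepWhole B9Thm312Whole B9Thm312WholeLeaf B9Thm312WholeLeft B9Thm312WholeH B9Thm313Whole
open B9Thm313WholeLeft B9Thm312WholeLeafLeftGlob B9Ineq347CoReading B9SectCDiffDict B9CoRealizesRel B9CoRealizesHRel B9RWSums343Holder
open B9RWSumsReadsRel B9RWSumsReadsNbr B9Ineq347 B9Thm312WholeClasses B9Thm312WholeHolder B9Thm312WholeL2 B9Thm312WholeBlocksRel B9Thm312WholeBlocksNbr B9Thm313WholeLeafRel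
open B9Thm312WholeHHolder B9Thm312WholeHHolderNbr B9Thm312WholeLeafRelH B9Thm313WholeHolder B9Thm313WholeL2G B9Thm313WholeL2GP B9Thm313WholeInput B9Thm313WholeBlocksNbr B9Thm312WholeLeafAll
open B9RWSums346SecondDiff B9Thm312WholeLeafCompleteNbr B9Thm313WholeBlocksNbrRec B9Thm312WholeBlocksNbrRec B9RWSums344InputFam B9Thm312WholeDir B9Thm312WholeBlocksPairM B9Thm313WholeDir B9Thm313WholeDirInput B9Thm313WholeBlocksPairM
open B9Thm313WholeLeafCompletePairM B9Thm312WholeLeafCompletePairM B9Thm312WholeDirB B9Thm313WholeDirInputB B9Thm312WholeBlocksPairMB B9Thm313WholeBlocksPairMB B9Thm313WholeLeafCompletePairMB B9Thm313WholeBlocksPairMZ B9Thm313WholeBlocksPairMBZ B9Thm313WholeLeafRelZ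
open B9Thm312WholeHZ B9Thm312WholeLeafRelHZ B9Thm313WholeZ B9Thm313WholeLeftZ B9Thm313WholeHolderZ B9Thm313WholeInputZ B9Thm313WholeDirZ B9Thm313WholeDirInputZ B9Thm313WholeDirInputBZ
open B9Thm313WholeL2GZ B9Thm313WholeL2GPZ B9Thm313WholeDirL2Z B9Thm313WholeLeafCompletePairMBZ
open B6KLevelCensusIndexV1 (KIdx)
open B9GeoNormsKLevelV1 (geo9K)
open B9CoRealizesRelAtLetters (RelB)
open B9GeoNormsKLevelModelSignsV1 (modelSignsOn_geo9K)
open Summit.QuantumFields.YangMills.Theorems.Prop7SectET3Members (hd3 memberIdx)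
open Summit.QuantumFields.YangMills.Theorems.Prop7SectET3Geometry (geoOK_geo9K)
open Summit.QuantumFields.YangMills.Theorems.Prop7SectET3BgClass (bgT3 cfgV1OfT3)
open Summit.QuantumFields.YangMills.Theorems.Prop7SectET3Letters (LettersRowZT3)
open Summit.QuantumFields.YangMills.Theorems.Prop7SectET3N06LeavesRecord (t313_of_pins_T3_completePairMBZ)
open Summit.QuantumFields.YangMills.Theorems.Prop7SectET3N06LeavesRecordH (t312_of_pins_T3_completePairMBZ)
open Summit.QuantumFields.YangMills.Theorems.Prop7SectET3ClassTransferRows (normG_row_of_t313_classTransferS normH₁_row_of_t312_classTransferS)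
open Summit.QuantumFields.YangMills.Theorems.Prop7SectET3KernelFamilyCanonical (exists_kernelFamily_structural)
open Summit.QuantumFields.YangMills.Theorems.Prop7SectET3OpsSymmetry (hsymGG_row_of_letterSymm hsym_row_of_letterSymm)
open T3ContinuumYM3Torus T3PrintedRegularMinimiser B6GlobalChartV1

variable {ℓ : ℕ} {hL : Odd (ℓ + 1) ∧ 1 < ℓ + 1} {c35 : ℝ}

/-! ## §1 The 𝔊 side (Theorem 3.13) -/

/-- ★★★ **THE REDUCED `norm_G` ROW WITH THE CLASS-TRANSFER INPUT IN THE ∃-SHAPE (BG-336)′** — ✓ `normG_row_of_evaluationRows` with `hCT : ClassTransferT3 ℓ hL c35` replaced by p06's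
`hCTS` (discharged by ✓ `reg335_reg336_T3_of_regPr` for `c35 ≥ c35₀(L)`); binders otherwise and conclusion VERBATIM.  Nothing of print asserted; NOT a discharge of N06(d = 3).
[cite: Balaban1985Variational, (117) p.295, (14) p.280; Balaban1985BackgroundPropagators, Thm 3.13 p.426, (3.41)–(3.47) pp.397–398; Balaban1985RegularSpaces, (1.33) p.82, Prop. 6 p.99] -/
theorem normG_row_of_evaluationRowsS [∀ i : KIdx 2 ℓ hd3 hL 1 1, Fintype (geo9K i).Site] [∀ i : KIdx 2 ℓ hd3 hL 1 1, DecidableEq (geo9K i).Site]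
    {X Y Z W PX PY : KIdx 2 ℓ hd3 hL 1 1 → Type} {P : Type} [∀ i, Fintype (X i)] [∀ i, DecidableEq (X i)] [∀ i, Fintype (Y i)]
    [∀ i, Fintype (Z i)] [∀ i, Fintype (W i)] [∀ i, Fintype (PX i)] [∀ i, Fintype (PY i)] [Fintype P]
    (𝔬 : ∀ i : KIdx 2 ℓ hd3 hL 1 1, Ops (geo9K i) (bgT3 i) (X i) (Y i) (Z i) (W i)) (H₀ : KIdx 2 ℓ hd3 hL 1 1 → Prop)
    (bH : ∀ i : KIdx 2 ℓ hd3 hL 1 1, BlockNorm (toB6 (geo9K i) 1 (H₀ i)) (W i → ℝ))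
    (𝔭 : ∀ i : KIdx 2 ℓ hd3 hL 1 1, HolderProbes (geo9K i) (bgT3 i) (X i) (Y i) (PX i) (PY i))
    (bHX : ∀ i : KIdx 2 ℓ hd3 hL 1 1, ℝ → BlockNorm (toB6 (geo9K i) 1 (H₀ i)) (X i → ℝ))
    (Dd Dds : ∀ i : KIdx 2 ℓ hd3 hL 1 1, (bgT3 i).Cfg → P → Module.End ℝ (X i → ℝ))
    (bHW : ∀ i : KIdx 2 ℓ hd3 hL 1 1, ℝ → BlockNorm (toB6 (geo9K i) 1 (H₀ i)) (W i → ℝ))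
    (ev : ∀ i : KIdx 2 ℓ hd3 hL 1 1, (geo9K i).Loc → X i → ℝ) (evY : ∀ i : KIdx 2 ℓ hd3 hL 1 1, (geo9K i).Loc → Y i → ℝ)
    (r Cev θ₁ θD θ₂ r₁ B₀ B₂ B₄ δ₀ δK σ ρ a₁ M₁ B₃ δ₃ ρ' α κ₀ : ℝ) (Bh Bi Bq BhD Bx Bd θH θI θV Br : ℝ → ℝ)
    (Bi2 Bd2 : ℝ → ℝ → ℝ)
    (hθ₁ : 0 ≤ θ₁) (hθD : 0 ≤ θD) (hθH : ∀ β, 0 ≤ β → β < 1 → 0 ≤ θH β) (hθI : ∀ ε, 0 < ε → 0 ≤ θI ε) (hθ₂ : 0 ≤ θ₂)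
    (hθV : ∀ ε, 0 < ε → 0 ≤ θV ε) (hr₁ : 0 ≤ r₁) (hB₀ : 0 ≤ B₀) (hB₂ : 0 ≤ B₂)
    (hB₃ : 0 ≤ B₃) (hB₄ : 0 ≤ B₄) (hBr : ∀ ε, 0 < ε → 0 ≤ Br ε) (hσ : 0 < σ) (hρ' : 0 < ρ') (hρ'ρ : ρ' + 3 * σ ≤ ρ) (hρ'ρ₅ : ρ' + 5 * σ ≤ ρ)
    (hσρ' : 3 * σ < (1 - α) * ρ')
    (hρS : ρ ≤ δ₀) (hρ₃ : ρ ≤ δ₃) (hρδ : ρ + σ ≤ δK) (ha₁ : 0 < a₁) (hM₁ : 0 < M₁)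
    (hα0 : 0 < α) (hα1 : α < 1) (hBi : ∀ ε, 0 < ε → ε ≤ 1 → 0 ≤ Bi ε) (hBd : ∀ ε, 0 < ε → ε ≤ 1 → 0 ≤ Bd ε)
    (hBi2 : ∀ ε β, 0 < ε → ε ≤ 1 → 0 ≤ β → β < 1 → 0 ≤ Bi2 ε β) (hBd2 : ∀ ε β, 0 < ε → ε ≤ 1 → 0 ≤ β → β < 1 → 0 ≤ Bd2 ε β)
    (hBh : ∀ β, 0 ≤ β → β < 1 → 0 ≤ Bh β) (hBq : ∀ β, 0 ≤ β → β < 1 → 0 ≤ Bq β) (hBhD : ∀ β, 0 ≤ β → β < 1 → 0 ≤ BhD β)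
    (hBx : ∀ β, 0 ≤ β → β < 1 → 0 ≤ Bx β) (hCev : 0 ≤ Cev)
    (hκ : ∀ i : KIdx 2 ℓ hd3 hL 1 1, (bH i).κ ≤ κ₀)
    (hκW : ∀ (i : KIdx 2 ℓ hd3 hL 1 1) (ε : ℝ), (bHW i ε).κ ≤ κ₀)
    -- ======== the TEN K-free EVALUATION ROWS (replace the kernel family `GG` and its six co-reading rows) ========
    (hoff : ∀ (i : KIdx 2 ℓ hd3 hL 1 1) (lam : (geo9K i).Loc) (y' : (geo9K i).Site), (geo9K i).suppIn lam y' →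
      ∀ x : X i, ¬ RelB i ((𝔬 i).blk x) y' → ev i lam x = 0)
    (hoffY : ∀ (i : KIdx 2 ℓ hd3 hL 1 1) (lam : (geo9K i).Loc) (y' : (geo9K i).Site), (geo9K i).suppIn lam y' →
      ∀ w : Y i, ¬ RelB i ((𝔬 i).blkY w) y' → evY i lam w = 0)
    (hbd : ∀ (i : KIdx 2 ℓ hd3 hL 1 1) (lam : (geo9K i).Loc) (x : X i), |ev i lam x| ≤ (geo9K i).supNorm lam)
    (hbdY : ∀ (i : KIdx 2 ℓ hd3 hL 1 1) (lam : (geo9K i).Loc) (w : Y i), |evY i lam w| ≤ (geo9K i).supNorm lam)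
    (hwb : ∀ (i : KIdx 2 ℓ hd3 hL 1 1) (lam : (geo9K i).Loc) (γ : ℝ) (x : X i), |ev i lam x| ≤ (geo9K i).len ((𝔬 i).blk x) ^ γ * (geo9K i).wNorm γ lam)
    (hwbY : ∀ (i : KIdx 2 ℓ hd3 hL 1 1) (lam : (geo9K i).Loc) (γ : ℝ) (w : Y i), |evY i lam w| ≤ (geo9K i).len ((𝔬 i).blkY w) ^ γ * (geo9K i).wNorm γ lam)
    (hl2b : ∀ (i : KIdx 2 ℓ hd3 hL 1 1) (lam : (geo9K i).Loc) (y' y'' : (geo9K i).Site), (geo9K i).suppIn lam y' → RelB i y'' y' →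
      bl2 (g := toB6 (geo9K i) 1 (H₀ i)) (𝔬 i).blk y'' (ev i lam) ≤ Cev * (geo9K i).l2Norm lam)
    (hl2bY : ∀ (i : KIdx 2 ℓ hd3 hL 1 1) (lam : (geo9K i).Loc) (y' y'' : (geo9K i).Site), (geo9K i).suppIn lam y' → RelB i y'' y' →
      bl2 (g := toB6 (geo9K i) 1 (H₀ i)) (𝔬 i).blkY y'' (evY i lam) ≤ Cev * (geo9K i).l2Norm lam)
    (hloc : ∀ (i : KIdx 2 ℓ hd3 hL 1 1) (ε : ℝ) (lam : (geo9K i).Loc) (y' : (geo9K i).Site), (geo9K i).suppInT lam y' → (bHX i ε).IsLoc y' (ev i lam))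
    (hlocle : ∀ (i : KIdx 2 ℓ hd3 hL 1 1) (ε : ℝ) (lam : (geo9K i).Loc) (y' : (geo9K i).Site), (geo9K i).suppInT lam y' →
      (bHX i ε).loc y' (ev i lam) ≤ (geo9K i).holder ε lam + (geo9K i).supNorm lam)
    -- ======== the LETTER-SYMMETRY ROW (replaces `hsymGG`) ========
    (hls : ∀ i : KIdx 2 ℓ hd3 hL 1 1, M₁ ≤ (geo9K i).M → ∀ α₀ : ℝ, 0 < α₀ → (geo9K i).M * α₀ ≤ a₁ →
      ∀ U : (bgT3 i).Cfg, (bgT3 i).Reg335 c35 α₀ U → (bgT3 i).Reg336 c35 α₀ U →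
        IsTransposePair ((𝔬 i).S0 U) ((𝔬 i).S0 U) ∧ IsTransposePair ((𝔬 i).Tpi U) ((𝔬 i).Tpi U) ∧
          IsTransposePair ((𝔬 i).T2 U) ((𝔬 i).T2 U) ∧ IsTransposePair ((𝔬 i).D U) ((𝔬 i).Dstar U))
    -- ======== the analytic rows, VERBATIM ========
    (hmodel : ∀ i : KIdx 2 ℓ hd3 hL 1 1, M₁ ≤ (geo9K i).M → ∀ α₀ : ℝ, 0 < α₀ → (geo9K i).M * α₀ ≤ a₁ →
      ∀ U : (bgT3 i).Cfg, (bgT3 i).Reg335 c35 α₀ U → (bgT3 i).Reg336 c35 α₀ U →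
        Thm33G0 (𝔬 i) 1 (H₀ i) B₀ δ₀ U ∧
        Step (𝔬 i) 1 (H₀ i) (geoOK_geo9K i).lenle 1 (θ₁ * ((geo9K i).M * α₀)) δK U ∧
        Step (𝔬 i) 1 (H₀ i) (geoOK_geo9K i).lenle 2 (θ₁ * ((geo9K i).M * α₀)) δK U ∧
        FormSmall (𝔬 i) (r₁ * ((geo9K i).M * α₀)) U ∧ Identities (𝔬 i) U)
    (hleft : ∀ i : KIdx 2 ℓ hd3 hL 1 1, M₁ ≤ (geo9K i).M → ∀ α₀ : ℝ, 0 < α₀ → (geo9K i).M * α₀ ≤ a₁ →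
      ∀ U : (bgT3 i).Cfg, (bgT3 i).Reg335 c35 α₀ U → (bgT3 i).Reg336 c35 α₀ U →
        LeftStep (𝔬 i) 1 (H₀ i) (geoOK_geo9K i).lenle B₀ δ₀ (θD * ((geo9K i).M * α₀)) δK U)
    (wZ : ∀ i : KIdx 2 ℓ hd3 hL 1 1, (geo9K i).Site → ℝ) (hwZ : ∀ i y, 0 < wZ i y)
    (hletters : LettersRowZT3 𝔬 (fun _ => 1) H₀ wZ hwZ c35 a₁ M₁ B₃ δ₃)
    (hlettersD : ∀ i : KIdx 2 ℓ hd3 hL 1 1, M₁ ≤ (geo9K i).M → ∀ α₀ : ℝ, 0 < α₀ → (geo9K i).M * α₀ ≤ a₁ →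
      ∀ U : (bgT3 i).Cfg, (bgT3 i).Reg335 c35 α₀ U → (bgT3 i).Reg336 c35 α₀ U →
        Letters313DZ (𝔬 i) 1 (H₀ i) (geoOK_geo9K i) (wZ i) (hwZ i) B₃ δ₃ (bH i) U ∧
          Letters313DMZ (𝔬 i) (𝔭 i) (Dd i) 1 (H₀ i) (geoOK_geo9K i) (wZ i) (hwZ i) B₃ Bq δ₃ (bH i) U)
    (hG0C : ∀ i : KIdx 2 ℓ hd3 hL 1 1, M₁ ≤ (geo9K i).M → ∀ α₀ : ℝ, 0 < α₀ → (geo9K i).M * α₀ ≤ a₁ →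
      ∀ U : (bgT3 i).Cfg, (bgT3 i).Reg335 c35 α₀ U → (bgT3 i).Reg336 c35 α₀ U →
        Thm33G0Dir (𝔬 i) (𝔭 i) (Dd i) (Dds i) 1 (H₀ i) (bHX i) B₀ Bh Bi Bi2 δ₀ U ∧
          Thm33G0DirR (𝔬 i) (Dds i) 1 (H₀ i) B₀ δ₀ U)
    (hstepD : ∀ i : KIdx 2 ℓ hd3 hL 1 1, M₁ ≤ (geo9K i).M → ∀ α₀ : ℝ, 0 < α₀ → (geo9K i).M * α₀ ≤ a₁ →
      ∀ U : (bgT3 i).Cfg, (bgT3 i).Reg335 c35 α₀ U → (bgT3 i).Reg336 c35 α₀ U →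
        StepDirB (𝔬 i) (𝔭 i) (Dd i) (Dds i) 1 (H₀ i) (bHX i) (geoOK_geo9K i).lenle (θD * ((geo9K i).M * α₀))
          (fun β => θH β * ((geo9K i).M * α₀)) (fun ε => θI ε * ((geo9K i).M * α₀)) δK U)
    (hLHH : ∀ i : KIdx 2 ℓ hd3 hL 1 1, M₁ ≤ (geo9K i).M → ∀ α₀ : ℝ, 0 < α₀ → (geo9K i).M * α₀ ≤ a₁ →
      ∀ U : (bgT3 i).Cfg, (bgT3 i).Reg335 c35 α₀ U → (bgT3 i).Reg336 c35 α₀ U →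
        LettersHHZ (𝔬 i) (𝔭 i) 1 (H₀ i) (geoOK_geo9K i).lenle
          (weightNorm (BlockNorm.ofBlocks (toB6 (geo9K i) 1 (H₀ i)) (𝔬 i).blkZ) (wZ i) fun y => (hwZ i y).le) Bq δ₃ U)
    (hLH3 : ∀ i : KIdx 2 ℓ hd3 hL 1 1, M₁ ≤ (geo9K i).M → ∀ α₀ : ℝ, 0 < α₀ → (geo9K i).M * α₀ ≤ a₁ →
      ∀ U : (bgT3 i).Cfg, (bgT3 i).Reg335 c35 α₀ U → (bgT3 i).Reg336 c35 α₀ U →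
        Letters313HZ (𝔬 i) (𝔭 i) 1 (H₀ i) (geoOK_geo9K i) (wZ i) (hwZ i) (bH i) BhD Bx δ₃ U)
    (hG0L2 : ∀ i : KIdx 2 ℓ hd3 hL 1 1, M₁ ≤ (geo9K i).M → ∀ α₀ : ℝ, 0 < α₀ → (geo9K i).M * α₀ ≤ a₁ →
      ∀ U : (bgT3 i).Cfg, (bgT3 i).Reg335 c35 α₀ U → (bgT3 i).Reg336 c35 α₀ U →
        Thm33G0L2M (𝔬 i) (Dd i) (Dds i) 1 (H₀ i) B₂ δ₀ U)
    (hstepL2 : ∀ i : KIdx 2 ℓ hd3 hL 1 1, M₁ ≤ (geo9K i).M → ∀ α₀ : ℝ, 0 < α₀ → (geo9K i).M * α₀ ≤ a₁ →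
      ∀ U : (bgT3 i).Cfg, (bgT3 i).Reg335 c35 α₀ U → (bgT3 i).Reg336 c35 α₀ U →
        StepL2 (𝔬 i) 1 (H₀ i) (θ₂ * ((geo9K i).M * α₀)) δK U)
    (vZ : ∀ i : KIdx 2 ℓ hd3 hL 1 1, (geo9K i).Site → ℝ) (hvZ : ∀ i y, 0 < vZ i y)
    (hLL2 : ∀ i : KIdx 2 ℓ hd3 hL 1 1, M₁ ≤ (geo9K i).M → ∀ α₀ : ℝ, 0 < α₀ → (geo9K i).M * α₀ ≤ a₁ →
      ∀ U : (bgT3 i).Cfg, (bgT3 i).Reg335 c35 α₀ U → (bgT3 i).Reg336 c35 α₀ U →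
        Letters313L2PZ (𝔬 i) (Dd i) (Dds i) 1 (H₀ i) B₄ δ₃ (vZ i) (hvZ i) U ∧
          Letters313L2MZ (𝔬 i) (Dd i) (Dds i) 1 (H₀ i) B₄ δ₃ (vZ i) (hvZ i) U)
    (hLIM : ∀ i : KIdx 2 ℓ hd3 hL 1 1, M₁ ≤ (geo9K i).M → ∀ α₀ : ℝ, 0 < α₀ → (geo9K i).M * α₀ ≤ a₁ →
      ∀ U : (bgT3 i).Cfg, (bgT3 i).Reg335 c35 α₀ U → (bgT3 i).Reg336 c35 α₀ U →
        Letters313IMB (𝔬 i) (𝔭 i) (Dd i) (Dds i) 1 (H₀ i) (geoOK_geo9K i).lenle (bHX i) (bHW i) Br (fun ε => θV ε * ((geo9K i).M * α₀))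
          Bd Bd2 δ₃ δK U)
    -- ======== the class-transfer row in the ∃-shape (BG-336)′ of ✓`Prop7SectET3ClassTransferRows` (discharged by `reg335_reg336_T3_of_regPr` for `c35 ≥ c35₀(L)`), the normed family, its weight pin and the readout row ========
    (hCTS : ∃ a₅ : ℝ, 0 < a₅ ∧ ∀ (hℓ : 4 ≤ ℓ) (m : ℕ) (hm : 1 ≤ m) (n K a' R : ℕ) (hk1 : 1 ≤ K - n) (hsize : a' + 3 ≤ m + n) (hM8 : 8 ≤ (ℓ + 1) ^ a')
      (hR2 : 2 * (ℓ + 1) ^ 2 ≤ R) (α₀ : ℝ), 0 < α₀ → ((ℓ + 1 : ℕ) : ℝ) * (((ℓ + 1) ^ a' : ℕ) : ℝ) * α₀ ≤ a₅ →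
      ∀ U₀ : GaugeField (PV 2 ℓ m K hd3 hL) 0 (Matrix.specialUnitaryGroup (Fin 2) ℂ), RegPr (⟨ℓ + 1, hL, m, hm⟩ : T3Family) n K α₀ U₀ →
        (bgT3 (memberIdx ℓ hL hℓ m hm n K a' R hk1 hsize hM8 hR2)).Reg335 c35 α₀ (cfgV1OfT3 U₀) ∧
          (bgT3 (memberIdx ℓ hL hℓ m hm n K a' R hk1 hsize hM8 hR2)).Reg336 c35 α₀ (cfgV1OfT3 U₀))
    {Xo Yo : ∀ i : KIdx 2 ℓ hd3 hL 1 1, (bgT3 i).Cfg → Type} [∀ i U, SeminormedAddCommGroup (Xo i U)] [∀ i U, SeminormedAddCommGroup (Yo i U)]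
    (Gop : ∀ (i : KIdx 2 ℓ hd3 hL 1 1) (U : (bgT3 i).Cfg), Xo i U → Yo i U) (ιo : ∀ (i : KIdx 2 ℓ hd3 hL 1 1) (U : (bgT3 i).Cfg), Xo i U → (geo9K i).Loc)
    (hw : ∀ (i : KIdx 2 ℓ hd3 hL 1 1) (U : (bgT3 i).Cfg) (f : Xo i U), (geo9K i).wNorm (-3) (ιo i U f) ≤ ‖f‖)
    (hread : ∀ (i : KIdx 2 ℓ hd3 hL 1 1) (U : (bgT3 i).Cfg) (f : Xo i U) (C : ℝ), 0 ≤ C →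
      (∀ x : X i, |(𝔬 i).GG U (ev i (ιo i U f)) x| ≤ C * B9.pref4 ((geo9K i).len ((𝔬 i).blk x)) 0 * (geo9K i).len ((𝔬 i).blk x) ^ (-3 : ℝ)) →
      (∀ w : Y i, |((𝔬 i).D U ∘ₗ (𝔬 i).GG U) (ev i (ιo i U f)) w| ≤ C * B9.pref4 ((geo9K i).len ((𝔬 i).blkY w)) 1 * (geo9K i).len ((𝔬 i).blkY w) ^ (-3 : ℝ)) →
        ‖Gop i U f‖ ≤ C) :
    ∃ M₄ a₀ B₀' : ℝ, 0 < M₄ ∧ 0 < a₀ ∧ 0 < B₀' ∧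
      ∀ (hℓ : 4 ≤ ℓ) (m : ℕ) (hm : 1 ≤ m) (n K a' R : ℕ) (hk1 : 1 ≤ K - n) (hsize : a' + 3 ≤ m + n) (hM8 : 8 ≤ (ℓ + 1) ^ a') (hR2 : 2 * (ℓ + 1) ^ 2 ≤ R),
        M₄ ≤ ((ℓ + 1 : ℕ) : ℝ) * (((ℓ + 1) ^ a' : ℕ) : ℝ) →
        ∀ (e : ℝ) (U₀ : GaugeField (PV 2 ℓ m K hd3 hL) 0 (Matrix.specialUnitaryGroup (Fin 2) ℂ)),
          RegPr (⟨ℓ + 1, hL, m, hm⟩ : T3Family) n K e U₀ → e ≤ a₀ / (((ℓ + 1 : ℕ) : ℝ) * (((ℓ + 1) ^ a' : ℕ) : ℝ)) →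
            ∀ f : Xo (memberIdx ℓ hL hℓ m hm n K a' R hk1 hsize hM8 hR2) (cfgV1OfT3 U₀),
              ‖Gop (memberIdx ℓ hL hℓ m hm n K a' R hk1 hsize hM8 hR2) (cfgV1OfT3 U₀) f‖ ≤ B₀' * ‖f‖ := by
  -- (1) the canonical kernel family, member by member (F2)
  have hK := fun i : KIdx 2 ℓ hd3 hL 1 1 =>
    exists_kernelFamily_structural (R := (1 : ℝ)) (H := H₀ i) (𝔬 i).GG (𝔬 i).D (𝔬 i).Dstar (Dd i) (Dds i) (𝔭 i) (bHX i) (𝔬 i).blk (𝔬 i).blkY (ev i) (evY i)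
      (RelB i) r Cev (fun _ _ _ => 0) (fun _ _ _ => 0) (hoff i) (hoffY i) (hbd i) (hbdY i) (hwb i) (hwbY i) (hl2b i) (hl2bY i) (hloc i) (hlocle i)
      (modelSignsOn_geo9K i).supNorm_nonneg (modelSignsOn_geo9K i).l2Norm_nonneg (modelSignsOn_geo9K i).cutSup_nonneg (modelSignsOn_geo9K i).cutH_nonneg
      (modelSignsOn_geo9K i).holder_nonneg (geoOK_geo9K i).lenpos
  choose GG _h3 _hg3 hcoR hco1R hcoG hl2N hH1N hIF _hd0 _hd1 _hd2 _hd4 hgd0 hgd1 _hgd2 hsg using hK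
  -- (2) the symmetry row (F1) from the `Identities` conjunct of `hmodel` and the letter symmetries
  have hsymGG := hsymGG_row_of_letterSymm 𝔬 c35 a₁ M₁ (fun i hM α₀ hα hMa U h5 h6 => (hmodel i hM α₀ hα hMa U h5 h6).2.2.2.2) hls
  -- (3) the (3.47) pin from the dominations and the readout row
  have hglob : ∀ (i : KIdx 2 ℓ hd3 hL 1 1) (U : (bgT3 i).Cfg) (f : Xo i U),
      ‖Gop i U f‖ ≤ max ((GG i).glob 0 U (ιo i U f) (-3)) ((GG i).glob 1 U (ιo i U f) (-3)) := by
    intro i U f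
    have h0 := (hsg i U (ιo i U f)).2.1 (-3)
    have hpl : ∀ (y : (geo9K i).Site) (n : Fin 4), 0 ≤ B9.pref4 ((geo9K i).len y) n * (geo9K i).len y ^ (-3 : ℝ) := fun y n =>
      mul_nonneg (B9FromB6.pref4_nonneg ((geoOK_geo9K i).lenpos y).le n) (Real.rpow_nonneg ((geoOK_geo9K i).lenpos y).le _)
    refine hread i U f _ (le_max_of_le_left h0.1) (fun x => (hgd0 i U (ιo i U f) (-3) x).trans ?_) (fun w => (hgd1 i U (ιo i U f) (-3) w).trans ?_)
    · rw [mul_assoc, mul_assoc]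
      exact mul_le_mul_of_nonneg_right (le_max_left _ _) (hpl _ 0)
    · rw [mul_assoc, mul_assoc]
      exact mul_le_mul_of_nonneg_right (le_max_right _ _) (hpl _ 1)
  exact normG_row_of_t313_classTransferS
    (t313_of_pins_T3_completePairMBZ 𝔬 H₀ GG bH 𝔭 bHX Dd Dds bHW ev evY r Cev θ₁ θD θ₂ r₁ B₀ B₂ B₄ δ₀ δK σ ρ a₁ M₁ B₃ δ₃ ρ' α κ₀ Bh Bi Bq BhD Bx Bd θH θI θV Br Bi2 Bd2
      hθ₁ hθD hθH hθI hθ₂ hθV hr₁ hB₀ hB₂ hB₃ hB₄ hBr hσ hρ' hρ'ρ hρ'ρ₅ hσρ' hρS hρ₃ hρδ ha₁ hM₁ hα0 hα1 hBi hBd hBi2 hBd2 hBh hBq hBhD hBx hCev hκ hκW hcoR hco1R hcoG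
      hsymGG hl2N hH1N hIF hmodel hleft wZ hwZ hletters hlettersD hG0C hstepD hLHH hLH3 hG0L2 hstepL2 vZ hvZ hLL2 hLIM
      (fun i => HasRWExpOfOps (𝔬 i)) (fun i => PosDefKOfOps (𝔬 i)) (fun _ => rfl) (fun _ => rfl))
    hCTS Gop ιo hw hglob

/-! ## §2 The H side (Theorem 3.12) -/

/-- ★★★ **THE REDUCED `norm_H₁` ROW WITH THE CLASS-TRANSFER INPUT IN THE ∃-SHAPE (BG-336)′** — ✓ `normH₁_row_of_evaluationRows` with `hCT` replaced by p06's `hCTS`; the H-kernel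
interface (`Hk H₁k hcoHR hHCN Hsel hmem hpin`), every other binder and the conclusion VERBATIM (so it serves `norm_H₁` and, at `Hsel := Hk`, `norm_H`).  Nothing of print asserted;
NOT a discharge of N06(d = 3).
[cite: Balaban1985Variational, (103) p.293, (45)-(46) p.285, (115) p.294; Balaban1985BackgroundPropagators, Thm 3.12 pp.421-423, (3.133) p.422; Balaban1984PropagatorsII, (2.61) p.234; Balaban1985RegularSpaces, (1.33) p.82, Prop. 6 p.99] -/
theorem normH₁_row_of_evaluationRowsS [∀ i : KIdx 2 ℓ hd3 hL 1 1, Fintype (geo9K i).Site] [∀ i : KIdx 2 ℓ hd3 hL 1 1, DecidableEq (geo9K i).Site]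
    {X Y Z W PX PY : KIdx 2 ℓ hd3 hL 1 1 → Type} {P : Type} [∀ i, Fintype (X i)] [∀ i, DecidableEq (X i)] [∀ i, Fintype (Y i)]
    [∀ i, Fintype (Z i)] [∀ i, Fintype (W i)] [∀ i, Fintype (PX i)] [∀ i, Fintype (PY i)] [Fintype P]
    (𝔬 : ∀ i : KIdx 2 ℓ hd3 hL 1 1, Ops (geo9K i) (bgT3 i) (X i) (Y i) (Z i) (W i)) (H₀ : KIdx 2 ℓ hd3 hL 1 1 → Prop)
    (𝔭 : ∀ i : KIdx 2 ℓ hd3 hL 1 1, HolderProbes (geo9K i) (bgT3 i) (X i) (Y i) (PX i) (PY i))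
    (bHX : ∀ i : KIdx 2 ℓ hd3 hL 1 1, ℝ → BlockNorm (toB6 (geo9K i) 1 (H₀ i)) (X i → ℝ))
    (Dd Dds : ∀ i : KIdx 2 ℓ hd3 hL 1 1, (bgT3 i).Cfg → P → Module.End ℝ (X i → ℝ))
    (Hk H₁k : ∀ i : KIdx 2 ℓ hd3 hL 1 1, B9.HKernel (geo9K i) (bgT3 i))
    (ev : ∀ i : KIdx 2 ℓ hd3 hL 1 1, (geo9K i).Loc → X i → ℝ) (evY : ∀ i : KIdx 2 ℓ hd3 hL 1 1, (geo9K i).Loc → Y i → ℝ)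
    (r Cev θ₁ θD θ₂ r₁ B₀ B₂ δ₀ δK σ ρ ρf a₁ M₁ B₃ δ₃ α : ℝ) (Bh Bi Bq θH θI : ℝ → ℝ) (Bi2 : ℝ → ℝ → ℝ)
    (hθ₁ : 0 ≤ θ₁) (hθD : 0 ≤ θD) (hθH : ∀ β, 0 ≤ β → β < 1 → 0 ≤ θH β) (hθI : ∀ ε, 0 < ε → 0 ≤ θI ε) (hθ₂ : 0 ≤ θ₂) (hr₁ : 0 ≤ r₁) (hB₀ : 0 ≤ B₀) (hB₂ : 0 ≤ B₂) (hB₃ : 0 ≤ B₃)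
    (hσ : 0 < σ) (hρ : 0 < ρ) (hρS : ρ ≤ δ₀) (hρδ : ρ + σ ≤ δK) (hρ₃ : ρ + σ ≤ δ₃) (ha₁ : 0 < a₁) (hM₁ : 0 < M₁)
    (hα : α ≤ 1 / 2) (hα0 : 0 < α) (hρf : 0 < ρf) (hρf1 : ρf + σ ≤ (1 - α) * ρ) (hρf2 : ρf + 2 * σ + α * ρ ≤ ρ)
    (hBh : ∀ β, 0 ≤ β → β < 1 → 0 ≤ Bh β) (hBi : ∀ ε, 0 < ε → ε ≤ 1 → 0 ≤ Bi ε)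
    (hBi2 : ∀ ε β, 0 < ε → ε ≤ 1 → 0 ≤ β → β < 1 → 0 ≤ Bi2 ε β) (hBq : ∀ β, 0 ≤ Bq β)
    (hCev : 0 ≤ Cev)
    -- ======== the TEN K-free EVALUATION ROWS (replace the kernel families `GD`, `G₁` and their rows `hcoR hco1R hcoG hl2N hH1N hIF`) ========
    (hoff : ∀ (i : KIdx 2 ℓ hd3 hL 1 1) (lam : (geo9K i).Loc) (y' : (geo9K i).Site), (geo9K i).suppIn lam y' →
      ∀ x : X i, ¬ RelB i ((𝔬 i).blk x) y' → ev i lam x = 0)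
    (hoffY : ∀ (i : KIdx 2 ℓ hd3 hL 1 1) (lam : (geo9K i).Loc) (y' : (geo9K i).Site), (geo9K i).suppIn lam y' →
      ∀ w : Y i, ¬ RelB i ((𝔬 i).blkY w) y' → evY i lam w = 0)
    (hbd : ∀ (i : KIdx 2 ℓ hd3 hL 1 1) (lam : (geo9K i).Loc) (x : X i), |ev i lam x| ≤ (geo9K i).supNorm lam)
    (hbdY : ∀ (i : KIdx 2 ℓ hd3 hL 1 1) (lam : (geo9K i).Loc) (w : Y i), |evY i lam w| ≤ (geo9K i).supNorm lam)
    (hwb : ∀ (i : KIdx 2 ℓ hd3 hL 1 1) (lam : (geo9K i).Loc) (γ : ℝ) (x : X i), |ev i lam x| ≤ (geo9K i).len ((𝔬 i).blk x) ^ γ * (geo9K i).wNorm γ lam)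
    (hwbY : ∀ (i : KIdx 2 ℓ hd3 hL 1 1) (lam : (geo9K i).Loc) (γ : ℝ) (w : Y i), |evY i lam w| ≤ (geo9K i).len ((𝔬 i).blkY w) ^ γ * (geo9K i).wNorm γ lam)
    (hl2b : ∀ (i : KIdx 2 ℓ hd3 hL 1 1) (lam : (geo9K i).Loc) (y' y'' : (geo9K i).Site), (geo9K i).suppIn lam y' → RelB i y'' y' →
      bl2 (g := toB6 (geo9K i) 1 (H₀ i)) (𝔬 i).blk y'' (ev i lam) ≤ Cev * (geo9K i).l2Norm lam)
    (hl2bY : ∀ (i : KIdx 2 ℓ hd3 hL 1 1) (lam : (geo9K i).Loc) (y' y'' : (geo9K i).Site), (geo9K i).suppIn lam y' → RelB i y'' y' →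
      bl2 (g := toB6 (geo9K i) 1 (H₀ i)) (𝔬 i).blkY y'' (evY i lam) ≤ Cev * (geo9K i).l2Norm lam)
    (hloc : ∀ (i : KIdx 2 ℓ hd3 hL 1 1) (ε : ℝ) (lam : (geo9K i).Loc) (y' : (geo9K i).Site), (geo9K i).suppInT lam y' → (bHX i ε).IsLoc y' (ev i lam))
    (hlocle : ∀ (i : KIdx 2 ℓ hd3 hL 1 1) (ε : ℝ) (lam : (geo9K i).Loc) (y' : (geo9K i).Site), (geo9K i).suppInT lam y' →
      (bHX i ε).loc y' (ev i lam) ≤ (geo9K i).holder ε lam + (geo9K i).supNorm lam)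
    -- ======== the H-kernel co-readings, VERBATIM ========
    (hcoHR : ∀ (i : KIdx 2 ℓ hd3 hL 1 1) (U : (bgT3 i).Cfg),
      CoRealizesHRel (Hk i) 0 U (2 + 1) (RelB i) (𝔬 i).blk (𝔬 i).blkZ ((𝔬 i).Hm U) ∧
      CoRealizesHRel (Hk i) 1 U (2 + 1) (RelB i) (𝔬 i).blkY (𝔬 i).blkZ ((𝔬 i).D U ∘ₗ (𝔬 i).Hm U) ∧
      CoRealizesHRel (H₁k i) 0 U (2 + 1) (RelB i) (𝔬 i).blk (𝔬 i).blkZ ((𝔬 i).H1m U) ∧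
      CoRealizesHRel (H₁k i) 1 U (2 + 1) (RelB i) (𝔬 i).blkY (𝔬 i).blkZ ((𝔬 i).D U ∘ₗ (𝔬 i).H1m U))
    (hHCN : ∀ (i : KIdx 2 ℓ hd3 hL 1 1) (U : (bgT3 i).Cfg),
      CoReadsHHolderNbr (Hk i) U (2 + 1) (𝔭 i) r (𝔬 i).blkZ ((𝔬 i).D U ∘ₗ (𝔬 i).Hm U) ∧
      CoReadsHHolderNbr (H₁k i) U (2 + 1) (𝔭 i) r (𝔬 i).blkZ ((𝔬 i).D U ∘ₗ (𝔬 i).H1m U))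
    -- ======== the LETTER-SYMMETRY ROW (replaces `hsym`) ========
    (hlsym : ∀ i : KIdx 2 ℓ hd3 hL 1 1, M₁ ≤ (geo9K i).M → ∀ α₀ : ℝ, 0 < α₀ → (geo9K i).M * α₀ ≤ a₁ →
      ∀ U : (bgT3 i).Cfg, (bgT3 i).Reg335 c35 α₀ U → (bgT3 i).Reg336 c35 α₀ U →
        IsTransposePair ((𝔬 i).S0 U) ((𝔬 i).S0 U) ∧ IsTransposePair ((𝔬 i).Tpi U) ((𝔬 i).Tpi U) ∧
          IsTransposePair ((𝔬 i).T2 U) ((𝔬 i).T2 U) ∧ IsTransposePair ((𝔬 i).D U) ((𝔬 i).Dstar U))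
    -- ======== the analytic rows, the class-transfer row and the (U)∕(Σ) pin, VERBATIM ========
    (hmodel : ∀ i : KIdx 2 ℓ hd3 hL 1 1, M₁ ≤ (geo9K i).M → ∀ α₀ : ℝ, 0 < α₀ → (geo9K i).M * α₀ ≤ a₁ →
      ∀ U : (bgT3 i).Cfg, (bgT3 i).Reg335 c35 α₀ U → (bgT3 i).Reg336 c35 α₀ U →
        Thm33G0 (𝔬 i) 1 (H₀ i) B₀ δ₀ U ∧
        Step (𝔬 i) 1 (H₀ i) (geoOK_geo9K i).lenle 1 (θ₁ * ((geo9K i).M * α₀)) δK U ∧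
        Step (𝔬 i) 1 (H₀ i) (geoOK_geo9K i).lenle 2 (θ₁ * ((geo9K i).M * α₀)) δK U ∧
        FormSmall (𝔬 i) (r₁ * ((geo9K i).M * α₀)) U ∧ Identities (𝔬 i) U)
    (hleft : ∀ i : KIdx 2 ℓ hd3 hL 1 1, M₁ ≤ (geo9K i).M → ∀ α₀ : ℝ, 0 < α₀ → (geo9K i).M * α₀ ≤ a₁ →
      ∀ U : (bgT3 i).Cfg, (bgT3 i).Reg335 c35 α₀ U → (bgT3 i).Reg336 c35 α₀ U →
        LeftStep (𝔬 i) 1 (H₀ i) (geoOK_geo9K i).lenle B₀ δ₀ (θD * ((geo9K i).M * α₀)) δK U)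
    (bZ : ∀ i : KIdx 2 ℓ hd3 hL 1 1, BlockNorm (toB6 (geo9K i) 1 (H₀ i)) (Z i → ℝ)) (hκZ : ∀ i : KIdx 2 ℓ hd3 hL 1 1, (bZ i).κ = 1)
    (hlettersH : ∀ i : KIdx 2 ℓ hd3 hL 1 1, M₁ ≤ (geo9K i).M → ∀ α₀ : ℝ, 0 < α₀ → (geo9K i).M * α₀ ≤ a₁ →
      ∀ U : (bgT3 i).Cfg, (bgT3 i).Reg335 c35 α₀ U → (bgT3 i).Reg336 c35 α₀ U →
        LettersHZ (𝔬 i) 1 (H₀ i) (geoOK_geo9K i) (bZ i) B₃ δ₃ U)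
    (hG0C : ∀ i : KIdx 2 ℓ hd3 hL 1 1, M₁ ≤ (geo9K i).M → ∀ α₀ : ℝ, 0 < α₀ → (geo9K i).M * α₀ ≤ a₁ →
      ∀ U : (bgT3 i).Cfg, (bgT3 i).Reg335 c35 α₀ U → (bgT3 i).Reg336 c35 α₀ U →
        Thm33G0Dir (𝔬 i) (𝔭 i) (Dd i) (Dds i) 1 (H₀ i) (bHX i) B₀ Bh Bi Bi2 δ₀ U ∧
          Thm33G0L2M (𝔬 i) (Dd i) (Dds i) 1 (H₀ i) B₂ δ₀ U)
    (hstepC : ∀ i : KIdx 2 ℓ hd3 hL 1 1, M₁ ≤ (geo9K i).M → ∀ α₀ : ℝ, 0 < α₀ → (geo9K i).M * α₀ ≤ a₁ →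
      ∀ U : (bgT3 i).Cfg, (bgT3 i).Reg335 c35 α₀ U → (bgT3 i).Reg336 c35 α₀ U →
        StepDirB (𝔬 i) (𝔭 i) (Dd i) (Dds i) 1 (H₀ i) (bHX i) (geoOK_geo9K i).lenle (θD * ((geo9K i).M * α₀))
          (fun β => θH β * ((geo9K i).M * α₀)) (fun ε => θI ε * ((geo9K i).M * α₀)) δK U ∧
        StepL2 (𝔬 i) 1 (H₀ i) (θ₂ * ((geo9K i).M * α₀)) δK U)
    (hLHH : ∀ i : KIdx 2 ℓ hd3 hL 1 1, M₁ ≤ (geo9K i).M → ∀ α₀ : ℝ, 0 < α₀ → (geo9K i).M * α₀ ≤ a₁ →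
      ∀ U : (bgT3 i).Cfg, (bgT3 i).Reg335 c35 α₀ U → (bgT3 i).Reg336 c35 α₀ U →
        LettersHHZ (𝔬 i) (𝔭 i) 1 (H₀ i) (geoOK_geo9K i).lenle (bZ i) Bq δ₃ U)
    -- ======== the class-transfer row (BG-336), the selected H-kernel and the operator family read by its (3.133) entries through the (U)∕(Σ) pin ========
    (hCTS : ∃ a₅ : ℝ, 0 < a₅ ∧ ∀ (hℓ : 4 ≤ ℓ) (m : ℕ) (hm : 1 ≤ m) (n K a' R : ℕ) (hk1 : 1 ≤ K - n) (hsize : a' + 3 ≤ m + n) (hM8 : 8 ≤ (ℓ + 1) ^ a')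
      (hR2 : 2 * (ℓ + 1) ^ 2 ≤ R) (α₀ : ℝ), 0 < α₀ → ((ℓ + 1 : ℕ) : ℝ) * (((ℓ + 1) ^ a' : ℕ) : ℝ) * α₀ ≤ a₅ →
      ∀ U₀ : GaugeField (PV 2 ℓ m K hd3 hL) 0 (Matrix.specialUnitaryGroup (Fin 2) ℂ), RegPr (⟨ℓ + 1, hL, m, hm⟩ : T3Family) n K α₀ U₀ →
        (bgT3 (memberIdx ℓ hL hℓ m hm n K a' R hk1 hsize hM8 hR2)).Reg335 c35 α₀ (cfgV1OfT3 U₀) ∧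
          (bgT3 (memberIdx ℓ hL hℓ m hm n K a' R hk1 hsize hM8 hR2)).Reg336 c35 α₀ (cfgV1OfT3 U₀))
    (Hsel : ∀ i : KIdx 2 ℓ hd3 hL 1 1, B9.HKernel (geo9K i) (bgT3 i)) (hmem : ∀ i, Hsel i = Hk i ∨ Hsel i = H₁k i)
    {Xo Yo : ∀ i : KIdx 2 ℓ hd3 hL 1 1, (bgT3 i).Cfg → Type} [∀ i U, SeminormedAddCommGroup (Xo i U)] [∀ i U, SeminormedAddCommGroup (Yo i U)]
    (Hop : ∀ (i : KIdx 2 ℓ hd3 hL 1 1) (U : (bgT3 i).Cfg), Xo i U → Yo i U) (s : ℝ)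
    (hls : ∀ (i : KIdx 2 ℓ hd3 hL 1 1) (y : (geo9K i).Site), (geo9K i).len y ^ s ≤ 1)
    (hpin : ∀ (i : KIdx 2 ℓ hd3 hL 1 1) (U : (bgT3 i).Cfg) (b : Xo i U) (c : ℝ), 0 ≤ c →
      (∀ (n : Fin 2) (y : (geo9K i).Site),
          (geo9K i).len y ^ ((n : ℝ) + s) * (∑ y' : (geo9K i).Site, (Hsel i).e n U y y' * (geo9K i).len y' ^ ((2 + 1 : ℕ) : ℝ)) * ‖b‖ ≤ c) →
        ‖Hop i U b‖ ≤ c) :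
    ∃ M₄ a₀ B₀' : ℝ, 0 < M₄ ∧ 0 < a₀ ∧ 0 < B₀' ∧
      ∀ (hℓ : 4 ≤ ℓ) (m : ℕ) (hm : 1 ≤ m) (n K a' R : ℕ) (hk1 : 1 ≤ K - n) (hsize : a' + 3 ≤ m + n) (hM8 : 8 ≤ (ℓ + 1) ^ a') (hR2 : 2 * (ℓ + 1) ^ 2 ≤ R),
        M₄ ≤ ((ℓ + 1 : ℕ) : ℝ) * (((ℓ + 1) ^ a' : ℕ) : ℝ) →
        ∀ (e : ℝ) (U₀ : GaugeField (PV 2 ℓ m K hd3 hL) 0 (Matrix.specialUnitaryGroup (Fin 2) ℂ)),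
          RegPr (⟨ℓ + 1, hL, m, hm⟩ : T3Family) n K e U₀ → e ≤ a₀ / (((ℓ + 1 : ℕ) : ℝ) * (((ℓ + 1) ^ a' : ℕ) : ℝ)) →
            ∀ b : Xo (memberIdx ℓ hL hℓ m hm n K a' R hk1 hsize hM8 hR2) (cfgV1OfT3 U₀),
              ‖Hop (memberIdx ℓ hL hℓ m hm n K a' R hk1 hsize hM8 hR2) (cfgV1OfT3 U₀) b‖ ≤ B₀' * ‖b‖ := by
  -- (1) the canonical kernel families for `G` and `G₁`, member by member (✓ `exists_kernelFamily_structural`)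
  have hKG := fun i : KIdx 2 ℓ hd3 hL 1 1 =>
    exists_kernelFamily_structural (R := (1 : ℝ)) (H := H₀ i) (𝔬 i).G (𝔬 i).D (𝔬 i).Dstar (Dd i) (Dds i) (𝔭 i) (bHX i) (𝔬 i).blk (𝔬 i).blkY (ev i) (evY i)
      (RelB i) r Cev (fun _ _ _ => 0) (fun _ _ _ => 0) (hoff i) (hoffY i) (hbd i) (hbdY i) (hwb i) (hwbY i) (hl2b i) (hl2bY i) (hloc i) (hlocle i)
      (modelSignsOn_geo9K i).supNorm_nonneg (modelSignsOn_geo9K i).l2Norm_nonneg (modelSignsOn_geo9K i).cutSup_nonneg (modelSignsOn_geo9K i).cutH_nonneg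
      (modelSignsOn_geo9K i).holder_nonneg (geoOK_geo9K i).lenpos
  have hKG1 := fun i : KIdx 2 ℓ hd3 hL 1 1 =>
    exists_kernelFamily_structural (R := (1 : ℝ)) (H := H₀ i) (𝔬 i).G1 (𝔬 i).D (𝔬 i).Dstar (Dd i) (Dds i) (𝔭 i) (bHX i) (𝔬 i).blk (𝔬 i).blkY (ev i) (evY i)
      (RelB i) r Cev (fun _ _ _ => 0) (fun _ _ _ => 0) (hoff i) (hoffY i) (hbd i) (hbdY i) (hwb i) (hwbY i) (hl2b i) (hl2bY i) (hloc i) (hlocle i)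
      (modelSignsOn_geo9K i).supNorm_nonneg (modelSignsOn_geo9K i).l2Norm_nonneg (modelSignsOn_geo9K i).cutSup_nonneg (modelSignsOn_geo9K i).cutH_nonneg
      (modelSignsOn_geo9K i).holder_nonneg (geoOK_geo9K i).lenpos
  choose GD _a3 _ag3 hcoR hco1R hcoG hl2N hH1N hIF _ad0 _ad1 _ad2 _ad4 _agd0 _agd1 _agd2 _asg using hKG
  choose G₁ _b3 _bg3 hcoR₁ hco1R₁ hcoG₁ hl2N₁ hH1N₁ hIF₁ _bd0 _bd1 _bd2 _bd4 _bgd0 _bgd1 _bgd2 _bsg using hKG1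
  -- (2) the symmetry row (✓ `hsym_row_of_letterSymm`) from the `Identities` conjunct of `hmodel` and the letter symmetries
  have hsym := hsym_row_of_letterSymm 𝔬 c35 a₁ M₁ (fun i hM α₀ hα hMa U h5 h6 => (hmodel i hM α₀ hα hMa U h5 h6).2.2.2.2) hlsym
  -- (3) the leaf of record + the ∃-shape class-transfer row BY NAME
  exact normH₁_row_of_t312_classTransferS
    (t312_of_pins_T3_completePairMBZ 𝔬 H₀ 𝔭 bHX Dd Dds GD G₁ Hk H₁k ev evY r Cev θ₁ θD θ₂ r₁ B₀ B₂ δ₀ δK σ ρ ρf a₁ M₁ B₃ δ₃ α Bh Bi Bq θH θI Bi2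
      hθ₁ hθD hθH hθI hθ₂ hr₁ hB₀ hB₂ hB₃ hσ hρ hρS hρδ hρ₃ ha₁ hM₁ hα hα0 hρf hρf1 hρf2 hBh hBi hBi2 hBq hCev
      (fun i U => ⟨(hcoR i U).1, (hcoR i U).2, (hcoR₁ i U).1, (hcoR₁ i U).2⟩) (fun i U => ⟨hco1R i U, hco1R₁ i U⟩) hcoHR
      (fun i U => ⟨(hcoG i U).1, (hcoG i U).2.1, (hcoG i U).2.2, (hcoG₁ i U).1, (hcoG₁ i U).2.1, (hcoG₁ i U).2.2⟩)
      (fun i U => ⟨hl2N i U, hl2N₁ i U⟩) (fun i U => ⟨hH1N i U, hH1N₁ i U⟩) (fun i U => ⟨hIF i U, hIF₁ i U⟩) hHCN hsym hmodel hleft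
      bZ hκZ hlettersH hG0C hstepC hLHH
      (fun i => HasRWExpOfOps (𝔬 i)) (fun i => HasRWExpHOfOps (𝔬 i)) (fun i => PosDefKOfOps (𝔬 i)) (fun _ => rfl) (fun _ => rfl) (fun _ => rfl))
    hCTS Hsel hmem Hop s hls hpin

end Summit.QuantumFields.YangMills.Theorems.Prop7SectET3N06LeavesRecordReducedS

end
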